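import Summits.CriticalPhenomena.CardyFormulaZ2.Theses.ModulusResponse
import Summits.CriticalPhenomena.CardyFormulaZ2.Theorems.ModulusResponseSmirnovCellAnchor
import Summits.CriticalPhenomena.CardyFormulaZ2.Theorems.ModulusResponseBondIdentification
import HarnessLib

/-!
# The open content of the crux `SegmentTransport` (stmt-CriticalPhenomena-11199) is bare linear-image
# universality on the self-dual cell segment, and its `u = 1/2` slice is the route target

Route `ModulusResponse` of `CriticalPhenomena/CardyFormulaZ2`. Notation: `μ_u` the pinned cell family on `ℤ²`
(`u ∈ [0,1/2]`), `S_t z = cosh t · z + i sinh t · z̄` the pinned diagonal stretches,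
`P_u(t, R, δ) = (μ u).real (discreteCrossing (S t '' R.carrier) δ (S t '' R.arc 0) (S t '' R.arc 2))`, `F` = Cardy's
function, and

  `U(u)` := "there is a stretch `t` with `P_u(t, R, ·) → F(η(R))` (`HasCrossingLimit`) for every conformal rectangle `R`"

(linear-image Cardy for `μ_u`; at `u ∈ (0,1/2]` this is an instance of the conjecture printed in Bollobás–Riordan,
*Percolation on self-dual polygon configurations*, arXiv:1001.4674, p. 40: for non-degenerate self-dual hyperlattice
models crossing probabilities "should be given by Cardy's formula, after first applying a suitable linear transformation
to the model"; "this has been proved by Smirnov for site percolation on the triangular lattice; this is essentially the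
only case known").

This file records, as theorems of the tree, what the crux asks beyond its antecedents:

* `segmentTransport_of_segmentUniversality` — `(∀ u ∈ [0,1/2], U(u)) → SegmentTransport`, unconditionally (the crux's
  RSW / anchor / response antecedents are simply not used);
* `segmentUniversality_of_segmentTransport` — conversely `SegmentRSW → SmirnovResponse → SegmentTransport →
  ∀ u ∈ [0,1/2], U(u)`: the anchor antecedent is a theorem of the tree (`smirnovCellAnchor_proof`, `t₀ = -(log 3)/4`) and
  the other two antecedents are the route's sibling cruxes, so modulo those the crux IS `∀ u ∈ [0,1/2], U(u)`
  (`segmentTransport_iff_segmentUniversality`);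
* `segmentUniversality_half_iff_linearImageCardyZ2` — `U(1/2) ↔ LinearImageCardyZ2` unconditionally (the cell measure at
  `u = 1/2` is `P_{1/2}` bond percolation on `ℤ²`, `bondIdentification_proof`): the slice of the crux that the route's
  deciding theorem consumes is exactly the route target (which `SquarePinning` turns into the summit statement);
* `segmentTransport_iff_target_and_interior`, `segmentTransport_of_target_and_interior` — modulo the sibling cruxes the
  crux is `LinearImageCardyZ2 ∧ (∀ u ∈ [0,1/2), U(u))`: the route target plus the Bollobás–Riordan instances at
  `0 ≤ u < 1/2` (of which only `u = 0` is a theorem, Smirnov), none of which any item of the route consumes.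

Together with `Cruxes.SegmentTransport.Birth.uniformCompensation_iff_segmentTransport` (the registered kernel stub of the
only line ↔ the crux) these are the formal backbone of the lead's terminal verdict on the crux (open problem: target slice
+ Bollobás–Riordan instances at `0 < u < 1/2`, no consumer of the latter inside the route).
-/

noncomputable section

namespace Summit.CriticalPhenomena.CardyFormulaZ2.Cruxes.SegmentTransport

open Summit.CriticalPhenomena.CardyFormulaZ2.Theses.ModulusResponse
open Summit.CriticalPhenomena.CardyFormulaZ2.Theorems

/-- **Bare linear-image universality on the segment implies the crux**, unconditionally: if for every
`u ∈ [0,1/2]` some stretch `t` makes `P_u(t, R, ·)` converge to `F(η(R))` for every conformal rectangle `R`,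
then `SegmentTransport` holds (its RSW, anchor and response antecedents are not used). [folklore] -/
theorem segmentTransport_of_segmentUniversality
    (hU : ∀ (μ : ℝ → MeasureTheory.Measure (Literature.Probability.Percolation.BondConfig (Literature.Probability.LatticeModels.Site 2))) (S : ℝ → ℂ → ℂ), (∀ u, μ u = MeasureTheory.Measure.map (fun p : Set (Literature.Probability.LatticeModels.Site 2) × Set (Literature.Probability.LatticeModels.Site 2) ↦ {e | ∃ m, (m ∈ p.1 ∧ e = s(m - Pi.single 0 1, m)) ∨ ((m ∈ p.1 ↔ m ∉ p.2) ∧ e = s(m - Pi.single 1 1, m))}) ((ProbabilityTheory.setBernoulli Set.univ Literature.Probability.Percolation.half).prod (ProbabilityTheory.setBernoulli Set.univ (Set.projIcc 0 1 zero_le_one u)))) → (∀ t z, S t z = (Real.cosh t : ℂ) * z + Complex.I * (Real.sinh t : ℂ) * (starRingEnd ℂ) z) → ∀ u ∈ Set.Icc (0 : ℝ) (1 / 2), ∃ t : ℝ, ∀ R : Literature.Probability.RandomPlanarGeometry.ConformalRectangle, R.HasCrossingLimit (fun δ ↦ (μ u).real (Literature.Probability.Percolation.discreteCrossing (S t ''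 R.carrier) δ (S t '' R.arc 0) (S t '' R.arc 2))) Literature.Probability.RandomPlanarGeometry.cardyFunction) :
    SegmentTransport := by
  intro μ S hμ hS _ _ _ u hu
  exact hU μ S hμ hS u hu

/-- **The crux implies bare linear-image universality on the segment**, given the route's two sibling cruxes
`SegmentRSW` (uniform box crossings) and `SmirnovResponse` (the `u = 0` response law); the anchor antecedent is
discharged by the tree's `smirnovCellAnchor_proof` (`t₀ = -(log 3)/4`). [folklore] -/
theorem segmentUniversality_of_segmentTransport (hRSW : SegmentRSW) (hResp : SmirnovResponse)
    (hT : SegmentTransport) :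
    ∀ (μ : ℝ → MeasureTheory.Measure (Literature.Probability.Percolation.BondConfig (Literature.Probability.LatticeModels.Site 2))) (S : ℝ → ℂ → ℂ), (∀ u, μ u = MeasureTheory.Measure.map (fun p : Set (Literature.Probability.LatticeModels.Site 2) × Set (Literature.Probability.LatticeModels.Site 2) ↦ {e | ∃ m, (m ∈ p.1 ∧ e = s(m - Pi.single 0 1, m)) ∨ ((m ∈ p.1 ↔ m ∉ p.2) ∧ e = s(m - Pi.single 1 1, m))}) ((ProbabilityTheory.setBernoulli Set.univ Literature.Probability.Percolation.half).prod (ProbabilityTheory.setBernoulli Set.univ (Set.projIcc 0 1 zero_le_one u)))) → (∀ t z, S t z = (Real.cosh t : ℂ) * z + Complex.I * (Real.sinh t : ℂ) * (starRingEnd ℂ) z) → ∀ u ∈ Set.Icc (0 : ℝ) (1 / 2), ∃ t : ℝ, ∀ R : Literature.Probability.RandomPlanarGeometry.ConformalRectangle, R.HasCrossingLimit (fun δ ↦ (μ u).real (Literature.Probability.Percolation.discreteCrossing (S t '' R.carrier) δ (S t '' R.arc 0) (S t '' R.arc 2))) Literature.Probability.RandomPlanarGeometry.cardyFunction := by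
  intro μ S hμ hS u hu
  exact hT μ S hμ hS (hRSW μ hμ) ⟨-(Real.log 3) / 4, smirnovCellAnchor_proof μ S hμ hS⟩ (hResp μ S hμ hS) u hu

/-- **Modulo the two sibling cruxes, `SegmentTransport` is exactly bare linear-image universality on the whole
segment `u ∈ [0,1/2]`** (the Bollobás–Riordan linear-image conjecture for the self-dual cell family, arXiv:1001.4674
p. 40, plus its `u = 1/2` slice, the route target). [folklore] -/
theorem segmentTransport_iff_segmentUniversality (hRSW : SegmentRSW) (hResp : SmirnovResponse) :
    SegmentTransport ↔
      ∀ (μ : ℝ → MeasureTheory.Measure (Literature.Probability.Percolation.BondConfig (Literature.Probability.LatticeModels.Site 2))) (S : ℝ → ℂ → ℂ), (∀ u, μ u = MeasureTheory.Measure.map (fun p : Set (Literature.Probability.LatticeModels.Site 2) × Set (Literature.Probability.LatticeModels.Site 2) ↦ {e | ∃ m, (m ∈ p.1 ∧ e = s(m - Pi.single 0 1, m)) ∨ ((m ∈ p.1 ↔ m ∉ p.2) ∧ e = s(m - Pi.single 1 1, m))}) ((ProbabilityTheory.setBernoulli Set.univ Literature.Probability.Percolation.half).prod (ProbabilityTheory.setBernoulli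 Set.univ (Set.projIcc 0 1 zero_le_one u)))) → (∀ t z, S t z = (Real.cosh t : ℂ) * z + Complex.I * (Real.sinh t : ℂ) * (starRingEnd ℂ) z) → ∀ u ∈ Set.Icc (0 : ℝ) (1 / 2), ∃ t : ℝ, ∀ R : Literature.Probability.RandomPlanarGeometry.ConformalRectangle, R.HasCrossingLimit (fun δ ↦ (μ u).real (Literature.Probability.Percolation.discreteCrossing (S t '' R.carrier) δ (S t '' R.arc 0) (S t '' R.arc 2))) Literature.Probability.RandomPlanarGeometry.cardyFunction :=
  ⟨segmentUniversality_of_segmentTransport hRSW hResp, segmentTransport_of_segmentUniversality⟩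

/-- **The `u = 1/2` slice of bare linear-image universality is the route target `LinearImageCardyZ2`**,
unconditionally: the cell measure at `u = 1/2` is `P_{1/2}` bond percolation on `ℤ²` (`bondIdentification_proof`),
and `discreteCrossingProb half` is its `discreteCrossing` probability by definition. So the only instance of the crux
consumed by the route's deciding theorem is literally the target. [folklore] -/
theorem segmentUniversality_half_iff_linearImageCardyZ2 :
    (∀ (μ : ℝ → MeasureTheory.Measure (Literature.Probability.Percolation.BondConfig (Literature.Probability.LatticeModels.Site 2))) (S : ℝ → ℂ → ℂ), (∀ u, μ u = MeasureTheory.Measure.map (fun p : Set (Literature.Probability.LatticeModels.Site 2) × Set (Literature.Probability.LatticeModels.Site 2) ↦ {e | ∃ m, (m ∈ p.1 ∧ e = s(m - Pi.single 0 1, m)) ∨ ((m ∈ p.1 ↔ m ∉ p.2) ∧ e = s(m - Pi.single 1 1, m))}) ((ProbabilityTheory.setBernoulli Set.univ Literature.Probability.Percolation.half).prod (ProbabilityTheory.setBernoulli Set.univ (Set.projIcc 0 1 zero_le_one u)))) → (∀ t z, S t z = (Real.cosh t : ℂ) * z + Complex.I * (Real.sinh t : ℂ) * (starRingEnd ℂ)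 z) → ∃ t : ℝ, ∀ R : Literature.Probability.RandomPlanarGeometry.ConformalRectangle, R.HasCrossingLimit (fun δ ↦ (μ (1 / 2)).real (Literature.Probability.Percolation.discreteCrossing (S t '' R.carrier) δ (S t '' R.arc 0) (S t '' R.arc 2))) Literature.Probability.RandomPlanarGeometry.cardyFunction) ↔
      LinearImageCardyZ2 := by
  constructor
  · intro h S hS
    have key : ∀ μ : ℝ → MeasureTheory.Measure
        (Literature.Probability.Percolation.BondConfig (Literature.Probability.LatticeModels.Site 2)),
        (∀ u, μ u = MeasureTheory.Measure.map
          (fun p : Set (Literature.Probability.LatticeModels.Site 2) ×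
              Set (Literature.Probability.LatticeModels.Site 2) ↦
            {e | ∃ m, (m ∈ p.1 ∧ e = s(m - Pi.single 0 1, m)) ∨
              ((m ∈ p.1 ↔ m ∉ p.2) ∧ e = s(m - Pi.single 1 1, m))})
          ((ProbabilityTheory.setBernoulli Set.univ Literature.Probability.Percolation.half).prod
            (ProbabilityTheory.setBernoulli Set.univ (Set.projIcc 0 1 zero_le_one u)))) →
        ∃ t : ℝ, ∀ R : Literature.Probability.RandomPlanarGeometry.ConformalRectangle,
          R.HasCrossingLimit (fun δ ↦ Literature.Probability.Percolation.discreteCrossingProb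
            Literature.Probability.Percolation.half (S t '' R.carrier) δ (S t '' R.arc 0) (S t '' R.arc 2))
            Literature.Probability.RandomPlanarGeometry.cardyFunction := by
      intro μ hμ
      obtain ⟨t, ht⟩ := h μ S hμ hS
      refine ⟨t, fun R ↦ ?_⟩
      have hR := ht R
      rw [bondIdentification_proof μ hμ] at hR
      exact hR
    exact key _ (fun _ ↦ rfl)
  · intro h μ S hμ hS
    obtain ⟨t, ht⟩ := h S hS
    refine ⟨t, fun R ↦ ?_⟩
    rw [bondIdentification_proof μ hμ]
    exact ht R

/-- **What the crux asks beyond the target**: modulo the sibling cruxes, `SegmentTransport` is the target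
`LinearImageCardyZ2` together with bare linear-image universality at every `u ∈ [0,1/2)` — the Bollobás–Riordan
instances that no item of the route consumes. [folklore] -/
theorem segmentTransport_iff_target_and_interior (hRSW : SegmentRSW) (hResp : SmirnovResponse) :
    SegmentTransport ↔
      (LinearImageCardyZ2 ∧
        ∀ (μ : ℝ → MeasureTheory.Measure (Literature.Probability.Percolation.BondConfig (Literature.Probability.LatticeModels.Site 2))) (S : ℝ → ℂ → ℂ), (∀ u, μ u = MeasureTheory.Measure.map (fun p : Set (Literature.Probability.LatticeModels.Site 2) × Set (Literature.Probability.LatticeModels.Site 2) ↦ {e | ∃ m, (m ∈ p.1 ∧ e = s(m - Pi.single 0 1, m)) ∨ ((m ∈ p.1 ↔ m ∉ p.2) ∧ e = s(m - Pi.single 1 1, m))}) ((ProbabilityTheory.setBernoulli Set.univ Literature.Probability.Percolation.half).prod (ProbabilityTheory.setBernoulli Set.univ (Set.projIcc 0 1 zero_le_one u)))) → (∀ t z, S t z = (Real.cosh t : ℂ) * z + Complex.I * (Real.sinh t : ℂ) * (starRingEnd ℂ) z) → ∀ u ∈ Set.Ico (0 : ℝ) (1 / 2), ∃ t : ℝ,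 ∀ R : Literature.Probability.RandomPlanarGeometry.ConformalRectangle, R.HasCrossingLimit (fun δ ↦ (μ u).real (Literature.Probability.Percolation.discreteCrossing (S t '' R.carrier) δ (S t '' R.arc 0) (S t '' R.arc 2))) Literature.Probability.RandomPlanarGeometry.cardyFunction) := by
  rw [segmentTransport_iff_segmentUniversality hRSW hResp]
  constructor
  · intro hU
    refine ⟨segmentUniversality_half_iff_linearImageCardyZ2.1 (fun μ S hμ hS ↦ hU μ S hμ hS (1 / 2) ⟨by norm_num, le_rfl⟩), ?_⟩
    intro μ S hμ hS u hu
    exact hU μ S hμ hS u (Set.Ico_subset_Icc_self hu)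
  · rintro ⟨hX, hI⟩ μ S hμ hS u hu
    rcases eq_or_lt_of_le hu.2 with h | h
    · rw [h]
      exact segmentUniversality_half_iff_linearImageCardyZ2.2 hX μ S hμ hS
    · exact hI μ S hμ hS u ⟨hu.1, h⟩

/-- **The crux, closed modulo exactly what is open**: given the sibling cruxes `SegmentRSW` and `SmirnovResponse`,
the route target `LinearImageCardyZ2` (≡ the summit up to `SquarePinning`; Schramm, ICM 2006, Problem 2.11) and bare
linear-image universality at every `u ∈ [0,1/2)` (Bollobás–Riordan, arXiv:1001.4674 p. 40, conjecture; `u = 0` is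
Smirnov's theorem, `smirnovCellAnchor_proof`) imply `SegmentTransport`. [folklore] -/
theorem segmentTransport_of_target_and_interior (hRSW : SegmentRSW) (hResp : SmirnovResponse)
    (hX : LinearImageCardyZ2)
    (hI : ∀ (μ : ℝ → MeasureTheory.Measure (Literature.Probability.Percolation.BondConfig (Literature.Probability.LatticeModels.Site 2))) (S : ℝ → ℂ → ℂ), (∀ u, μ u = MeasureTheory.Measure.map (fun p : Set (Literature.Probability.LatticeModels.Site 2) × Set (Literature.Probability.LatticeModels.Site 2) ↦ {e | ∃ m, (m ∈ p.1 ∧ e = s(m - Pi.single 0 1, m)) ∨ ((m ∈ p.1 ↔ m ∉ p.2) ∧ e = s(m - Pi.single 1 1, m))}) ((ProbabilityTheory.setBernoulli Set.univ Literature.Probability.Percolation.half).prod (ProbabilityTheory.setBernoulli Set.univ (Set.projIcc 0 1 zero_le_one u)))) → (∀ t z, S t z = (Real.cosh t : ℂ) * z + Complex.I * (Real.sinh t : ℂ) * (starRingEnd ℂ) z) → ∀ u ∈ Set.Ico (0 : ℝ) (1 / 2), ∃ t : ℝ, ∀ R : Literature.Probability.RandomPlanarGeometry.ConformalRectangle,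 R.HasCrossingLimit (fun δ ↦ (μ u).real (Literature.Probability.Percolation.discreteCrossing (S t '' R.carrier) δ (S t '' R.arc 0) (S t '' R.arc 2))) Literature.Probability.RandomPlanarGeometry.cardyFunction) :
    SegmentTransport :=
  (segmentTransport_iff_target_and_interior hRSW hResp).2 ⟨hX, hI⟩

end Summit.CriticalPhenomena.CardyFormulaZ2.Cruxes.SegmentTransport

end
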